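import Summits.AnomalousDissipation.AnomalousDissipation.Theorems.SolenoidalFractalHomogenisationRealisedQuasiStaticCellLawPrincipalCosetEnergy
import HarnessLib

/-!
# K2R `RealisedQuasiStaticCellLaw`, line `floquet-bloch`, stub `stub_lowSectorDecay` (S1D): the frame bridge between the
# slot frames of a sector (W-near regime)

Summits-side helper file (everything proved; no definitions, no named facts; `--supports stmt-AnomalousDissipation-20446`).
For a frequency `k ≠ 0` and two real unit normals `ζ₀, ζ ⊥ k` with Leray directions `p₀ = k̂ × ζ₀`, `p = k̂ × ζ`:
`ζ = rc•ζ₀ + rs•p₀` and `p = −rs•ζ₀ + rc•p₀` with `rc = ζ₀·ζ`, `rs = p₀·ζ`, `rc² + rs² = 1` (`frame_bridge_unit`,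
`frame_bridge_vec`); hence the
frame components of any `u ∈ ℂ³` rotate: `⟪ζ,u⟫ = rc⟪ζ₀,u⟫ + rs⟪p₀,u⟫`, `⟪p,u⟫ = −rs⟪ζ₀,u⟫ + rc⟪p₀,u⟫` (`frame_bridge_inner`)
— the `x ↦ R_j x` substitution that turns the `x`-level `comoving_start/junc/end` (…ComovingPairTransport) into the
`u`-level junction/start/end hypotheses of `isoSector_decay_ae`.
-/

set_option linter.dupNamespace false

noncomputable section

namespace Summit.AnomalousDissipation.AnomalousDissipation.Theorems.SolenoidalFractalHomogenisation.RealisedQuasiStaticCellLaw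

open Complex Matrix
open scoped ComplexConjugate Matrix

/-- **Frame bridge for an orthonormal frame** `(e₁, e₃ × e₁, e₃)`: a unit `x ⊥ e₃` and its partner `e₃ × x` in terms of
`e₁, e₃ × e₁`. -/
theorem frame_bridge_unit {R : Type*} [CommRing R] (e1 e3 x : Fin 3 → R) (h11 : e1 ⬝ᵥ e1 = 1) (h33 : e3 ⬝ᵥ e3 = 1)
    (h31 : e3 ⬝ᵥ e1 = 0) (hx1 : x ⬝ᵥ x = 1) (hx3 : x ⬝ᵥ e3 = 0) :
    x = (e1 ⬝ᵥ x) • e1 + ((e3 ⨯₃ e1) ⬝ᵥ x) • (e3 ⨯₃ e1) ∧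
      e3 ⨯₃ x = -((((e3 ⨯₃ e1) ⬝ᵥ x)) • e1) + (e1 ⬝ᵥ x) • (e3 ⨯₃ e1) ∧
      (e1 ⬝ᵥ x) * (e1 ⬝ᵥ x) + ((e3 ⨯₃ e1) ⬝ᵥ x) * ((e3 ⨯₃ e1) ⬝ᵥ x) = 1 := by
  have hexp := frame_expansion e1 e3 x h11 h33 h31 hx3
  refine ⟨hexp, ?_, ?_⟩
  · conv_lhs => rw [hexp]
    rw [map_add, map_smul, map_smul, frame_e3_cross_e2 e1 e3 h33 h31, smul_neg, add_comm]
  · have h2 : x ⬝ᵥ x = x ⬝ᵥ ((e1 ⬝ᵥ x) • e1 + ((e3 ⨯₃ e1) ⬝ᵥ x) • (e3 ⨯₃ e1)) := by rw [← hexp]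
    rw [hx1, dotProduct_add, dotProduct_smul, dotProduct_smul, smul_eq_mul, smul_eq_mul, dotProduct_comm x e1,
      dotProduct_comm x (e3 ⨯₃ e1)] at h2
    rw [← h2]

/-- **Frame bridge, vector form** for the frames of a sector: `k ≠ 0`, real unit normals `ζ₀, ζ ⊥ k`, Leray directions
`p₀ = k̂ × ζ₀`, `p = k̂ × ζ` (written `(|k|⁻¹ • k) ⨯₃ ζ`; `= |k|⁻¹ • (k ⨯₃ ζ)` by `LinearMap.map_smul₂`). -/
theorem frame_bridge_vec {k : Fin 3 → ℤ} (hk : k ≠ 0) {ζ₀ ζ : Fin 3 → ℝ} (h0 : ζ₀ ⬝ᵥ ζ₀ = 1)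
    (h0k : ζ₀ ⬝ᵥ (fun i => ((k i : ℤ) : ℝ)) = 0) (h1 : ζ ⬝ᵥ ζ = 1) (h1k : ζ ⬝ᵥ (fun i => ((k i : ℤ) : ℝ)) = 0) :
    ζ = (ζ₀ ⬝ᵥ ζ) • ζ₀ + ((((Real.sqrt ((fun i => ((k i : ℤ) : ℝ)) ⬝ᵥ (fun i => ((k i : ℤ) : ℝ))))⁻¹ • (fun i => ((k i : ℤ) : ℝ))) ⨯₃ ζ₀) ⬝ᵥ ζ) • (((Real.sqrt ((fun i => ((k i : ℤ) : ℝ)) ⬝ᵥ (fun i => ((k i : ℤ) : ℝ))))⁻¹ • (fun i => ((k i : ℤ) : ℝ))) ⨯₃ ζ₀) ∧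
      (((Real.sqrt ((fun i => ((k i : ℤ) : ℝ)) ⬝ᵥ (fun i => ((k i : ℤ) : ℝ))))⁻¹ • (fun i => ((k i : ℤ) : ℝ))) ⨯₃ ζ) = -(((((Real.sqrt ((fun i => ((k i : ℤ) : ℝ)) ⬝ᵥ (fun i => ((k i : ℤ) : ℝ))))⁻¹ • (fun i => ((k i : ℤ) : ℝ))) ⨯₃ ζ₀) ⬝ᵥ ζ) • ζ₀) + (ζ₀ ⬝ᵥ ζ) • (((Real.sqrt ((fun i => ((k i : ℤ) : ℝ)) ⬝ᵥ (fun i => ((k i : ℤ) : ℝ))))⁻¹ • (fun i => ((k i : ℤ) : ℝ))) ⨯₃ ζ₀) ∧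
      (ζ₀ ⬝ᵥ ζ) * (ζ₀ ⬝ᵥ ζ) + ((((Real.sqrt ((fun i => ((k i : ℤ) : ℝ)) ⬝ᵥ (fun i => ((k i : ℤ) : ℝ))))⁻¹ • (fun i => ((k i : ℤ) : ℝ))) ⨯₃ ζ₀) ⬝ᵥ ζ) * ((((Real.sqrt ((fun i => ((k i : ℤ) : ℝ)) ⬝ᵥ (fun i => ((k i : ℤ) : ℝ))))⁻¹ • (fun i => ((k i : ℤ) : ℝ))) ⨯₃ ζ₀) ⬝ᵥ ζ) = 1 := by
  have hkk : 0 < (fun i => ((k i : ℤ) : ℝ)) ⬝ᵥ (fun i => ((k i : ℤ) : ℝ)) := by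
    obtain ⟨i, hi⟩ : ∃ i, k i ≠ 0 := by
      by_contra h
      push Not at h
      exact hk (funext h)
    have hi' : (fun i => ((k i : ℤ) : ℝ)) i ≠ 0 := by simp [hi]
    have : (fun i => ((k i : ℤ) : ℝ)) ⬝ᵥ (fun i => ((k i : ℤ) : ℝ)) = ∑ l, (fun i => ((k i : ℤ) : ℝ)) l ^ 2 := by simp [dotProduct, sq]
    rw [this]
    exact lt_of_lt_of_le (by positivity) (Finset.single_le_sum (fun l _ => sq_nonneg ((fun i => ((k i : ℤ) : ℝ)) l))
      (Finset.mem_univ i))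
  obtain ⟨ρ, hρ⟩ : ∃ ρ : ℝ, ρ = Real.sqrt ((fun i => ((k i : ℤ) : ℝ)) ⬝ᵥ (fun i => ((k i : ℤ) : ℝ))) := ⟨_, rfl⟩
  rw [← hρ]
  have hρsq : ρ ^ 2 = (fun i => ((k i : ℤ) : ℝ)) ⬝ᵥ (fun i => ((k i : ℤ) : ℝ)) := by rw [hρ]; exact Real.sq_sqrt hkk.le
  have h33 : (ρ⁻¹ • (fun i => ((k i : ℤ) : ℝ))) ⬝ᵥ (ρ⁻¹ • (fun i => ((k i : ℤ) : ℝ))) = 1 := by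
    rw [smul_dotProduct, dotProduct_smul, smul_eq_mul, smul_eq_mul, ← hρsq]
    have hρ0 : ρ ≠ 0 := by rw [hρ]; exact (Real.sqrt_pos.2 hkk).ne'
    field_simp
  have h30 : (ρ⁻¹ • (fun i => ((k i : ℤ) : ℝ))) ⬝ᵥ ζ₀ = 0 := by
    rw [smul_dotProduct, dotProduct_comm (fun i => ((k i : ℤ) : ℝ)) ζ₀, h0k, smul_zero]
  have h31 : ζ ⬝ᵥ (ρ⁻¹ • (fun i => ((k i : ℤ) : ℝ))) = 0 := by rw [dotProduct_smul, h1k, smul_zero]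
  exact frame_bridge_unit ζ₀ (ρ⁻¹ • (fun i => ((k i : ℤ) : ℝ))) ζ h0 h33 h30 h1 h31

/-- **Frame bridge, component form**: the frame components of any `u ∈ ℂ³` in the frame `(ζ, p)` are the rotation by
`(rc, rs) = (ζ₀·ζ, p₀·ζ)` of its components in the frame `(ζ₀, p₀)`; and `rc² + rs² = 1`. -/
theorem frame_bridge_inner {k : Fin 3 → ℤ} (hk : k ≠ 0) {ζ₀ ζ : Fin 3 → ℝ} (h0 : ζ₀ ⬝ᵥ ζ₀ = 1)
    (h0k : ζ₀ ⬝ᵥ (fun i => ((k i : ℤ) : ℝ)) = 0) (h1 : ζ ⬝ᵥ ζ = 1) (h1k : ζ ⬝ᵥ (fun i => ((k i : ℤ) : ℝ)) = 0)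
    (u : EuclideanSpace ℂ (Fin 3)) :
    inner ℂ (WithLp.toLp 2 (Complex.ofReal ∘ ζ) : EuclideanSpace ℂ (Fin 3)) u =
        ((ζ₀ ⬝ᵥ ζ : ℝ) : ℂ) * inner ℂ (WithLp.toLp 2 (Complex.ofReal ∘ ζ₀) : EuclideanSpace ℂ (Fin 3)) u + (((((Real.sqrt ((fun i => ((k i : ℤ) : ℝ)) ⬝ᵥ (fun i => ((k i : ℤ) : ℝ))))⁻¹ • (fun i => ((k i : ℤ) : ℝ))) ⨯₃ ζ₀) ⬝ᵥ ζ : ℝ) : ℂ) * inner ℂ (WithLp.toLp 2 (Complex.ofReal ∘ (((Real.sqrt ((fun i => ((k i : ℤ) : ℝ)) ⬝ᵥ (fun i => ((k i : ℤ) : ℝ))))⁻¹ • (fun i => ((k i : ℤ) : ℝ))) ⨯₃ ζ₀)) : EuclideanSpace ℂ (Fin 3)) u ∧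
      inner ℂ (WithLp.toLp 2 (Complex.ofReal ∘ (((Real.sqrt ((fun i => ((k i : ℤ) : ℝ)) ⬝ᵥ (fun i => ((k i : ℤ) : ℝ))))⁻¹ • (fun i => ((k i : ℤ) : ℝ))) ⨯₃ ζ)) : EuclideanSpace ℂ (Fin 3)) u =
        -(((((Real.sqrt ((fun i => ((k i : ℤ) : ℝ)) ⬝ᵥ (fun i => ((k i : ℤ) : ℝ))))⁻¹ • (fun i => ((k i : ℤ) : ℝ))) ⨯₃ ζ₀) ⬝ᵥ ζ : ℝ) : ℂ) * inner ℂ (WithLp.toLp 2 (Complex.ofReal ∘ ζ₀) : EuclideanSpace ℂ (Fin 3)) u + ((ζ₀ ⬝ᵥ ζ : ℝ) : ℂ) * inner ℂ (WithLp.toLp 2 (Complex.ofReal ∘ (((Real.sqrt ((fun i => ((k i : ℤ) : ℝ)) ⬝ᵥ (fun i => ((k i : ℤ) : ℝ))))⁻¹ • (fun i => ((k i : ℤ) : ℝ))) ⨯₃ ζ₀)) : EuclideanSpace ℂ (Fin 3)) u ∧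
      (ζ₀ ⬝ᵥ ζ) ^ 2 + ((((Real.sqrt ((fun i => ((k i : ℤ) : ℝ)) ⬝ᵥ (fun i => ((k i : ℤ) : ℝ))))⁻¹ • (fun i => ((k i : ℤ) : ℝ))) ⨯₃ ζ₀) ⬝ᵥ ζ) ^ 2 = 1 := by
  obtain ⟨hζ, hp, hn⟩ := frame_bridge_vec hk h0 h0k h1 h1k
  have key : ∀ (a b : ℝ) (v w : Fin 3 → ℝ),
      inner ℂ (WithLp.toLp 2 (Complex.ofReal ∘ (a • v + b • w)) : EuclideanSpace ℂ (Fin 3)) u =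
        (a : ℂ) * inner ℂ (WithLp.toLp 2 (Complex.ofReal ∘ v) : EuclideanSpace ℂ (Fin 3)) u +
          (b : ℂ) * inner ℂ (WithLp.toLp 2 (Complex.ofReal ∘ w) : EuclideanSpace ℂ (Fin 3)) u := by
    intro a b v w
    rw [inner_toLp_ofReal_comp, inner_toLp_ofReal_comp, inner_toLp_ofReal_comp]
    simp only [dotProduct, Function.comp_apply, Pi.add_apply, Pi.smul_apply, smul_eq_mul, Finset.mul_sum,
      ← Finset.sum_add_distrib]
    refine Finset.sum_congr rfl fun i _ => ?_
    push_cast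
    ring
  refine ⟨?_, ?_, by rw [sq, sq]; exact hn⟩
  · conv_lhs => rw [hζ]
    exact key _ _ ζ₀ _
  · rw [hp, ← neg_smul, key]
    push_cast
    ring

end Summit.AnomalousDissipation.AnomalousDissipation.Theorems.SolenoidalFractalHomogenisation.RealisedQuasiStaticCellLaw

end
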